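/-
Copyright: the b2b-balaban T⁴-continuum CRUX team, row NE7b owner lineage `t4-ne7b-p1` (gen 115). Project licence.
-/
import Summits.QuantumFields.BalabanUV.T4Continuum.Spine.NE7b.SupNextScalePropagator
import Summits.QuantumFields.BalabanUV.T4Continuum.Spine.NE7b.SupNextScaleLocality

/-!
# THE NEXT-SCALE PROPAGATOR DEPENDS ON THE BACKGROUND FIELD EXPONENTIALLY LOCALLY: if `u` solves `R(w)u = f` and `u′` solves
# `R(w′)u′ = f` for the next-scale operators `R(·) = Q′∘(A + N′(σ·))∘Dσ(·)` at two backgrounds, then `u − u′` solves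
# `R(w)(u − u′) = (R(w′) − R(w))u′`, whose weighted size (65) §4 bounds by the DIFFERENCE letters of (64) §4; (66)'s a-priori letter then
# gives `e^{μρ(z)}|(u − u′)(z)| ≤ (1 − θ)⁻¹·C_Q(μ)·((e^{μ(n+1)}c0K_d(1) + λ)R_Δ + R_s)` — the decoupling letter one scale up
# (row NE7b, node U5c; (65) + (66) BY NAME, generic in the displayed letters; [folklore])

Cell `pub-balaban`, sub-cell `t4`, spine estimate NE7b (`T4WeightBudget.RelWeightBound`; the cell's OWN estimate — NOT PRINTED in
[Bałaban 1983–89], NOT PROVED).  Crux-route work under `Spine/NE7b/` by the row OWNER (`t4-ne7b-p1` gen 115) under FREEZE (0)'s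
crux-prover clause (FILING-CLAIM C-ne7bp1-g115-9); NOTHING of Bałaban's is named, valued or asserted; no `def`, no notation; zero
`sorry`.  Imports (BY NAME): the owner's (66) `…SupNextScalePropagator` (`weighted_nextScale_inverse_apriori`) and (65)
`…SupNextScaleLocality` (`weighted_nextScale_sub_of_letters`).

WHY (located).  (64) localised the dependence of `σ`, `Dσ`, `C̃` on the background; (66) ∕ (67) made the next-scale propagator exist and
localised.  The cluster expansion at the NEXT scale also needs the propagator's dependence on the background to be local — the same
two lemmas composed: `R(w)` is linear, so `R(w)(u − u′) = f − R(w)u′ = R(w′)u′ − R(w)u′`, a source (65) §4 measures.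

WHAT IS PROVED ([folklore]): **`weighted_nextScale_inverse_sub`** (`d ≥ 3`, `0 ≤ μ < δ_u∕4`, `ρ` bounded admissible, (66)'s `θ < 1`):
for `Q′, A, P` displayed, `N′ = g·`, `N″ = g′·` (`|g| ≤ λ`), responses `D` (with `Q′∘D = 1`, the fibre equation at `g`, and the weighted
letter of constant `K`) and `D′`, and `u, u′, f ∈ ℓ^∞` with `Q′(A(Du) + N′(Du)) = f = Q′(A(D′u′) + N″(D′u′))`: given the difference letters
`e^{μρ(blk p)}|((D − D′)u′)(p)| ≤ R_Δ`, `e^{μρ(blk q)}|(g − g′)(q)·(D′u′)(q)| ≤ R_s`,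
**`e^{μρ(z)}|(u − u′)(z)| ≤ (1 − θ)⁻¹·cU K_d(δ_u − μ)·((e^{μ(n+1)}c0K_d(1) + λ)R_Δ + R_s)`**.

HONEST (what this is NOT).  Generic composition; constants existential; the difference letters are hypotheses ((64) §4 supplies them
from `‖w − w′‖_{μ,ρ}` for (63)'s objects); scalar `ℤ^d` skeleton, not the torus, not the covariant operators; nothing of Bałaban's.
BY-NAME EFFECT ON THE WALL: NONE.  NE7b NOT PRINTED ∕ NOT PROVED; spine PROVED 0∕9; rung (B)+1 on a FINITE torus — NOT infinite volume,
NOT the mass gap, NOT Clay.  HONEST DEPENDENCY: continuum YM on T⁴ ⇐ BetaPertH ∧ nine spine estimates (0∕9 proved); BetaPertH ⇐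
(D1) ∧ (D4) ∧ CAP+tail; G-an2-4 gates asym, D1 and NE2∕3∕4.
-/

set_option autoImplicit false

noncomputable section

namespace Summit.QuantumFields.BalabanUV.T4Continuum.NE7b.SupNextScalePropagatorModulus

open scoped ENNReal
open Literature.MathematicalPhysics.QuantumFieldTheory.Balaban1983to89
open B4Sect5Proof (latticeConst latticeConst_nonneg)
open B6QGQLower276 (X blk B AX c0)
open B6QGQDecay237 (deltaU deltaU_pos cU)
open B5Hk103ScalarZd (nbhd)
open Summit.QuantumFields.BalabanUV.Beta.D1BFx.BlockColumnSupNorm (cHs)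
open Summit.QuantumFields.BalabanUV.Beta.D1BFx.PointColumnSplit (cKL cG0 cSplit)
open Summit.QuantumFields.BalabanUV.Beta.D1BFx.PointColumnDecay (cFar)
open SupNextScalePropagator (weighted_nextScale_inverse_apriori)
open SupNextScaleLocality (weighted_nextScale_sub_of_letters)

variable {d : ℕ}

/-- **THE NEXT-SCALE PROPAGATOR's WEIGHTED DEPENDENCE ON THE BACKGROUND** (`d ≥ 3`, `0 ≤ μ < δ_u∕4`, (66)'s `θ < 1`): two solutions
`u`, `u′` of `R(w)u = f`, `R(w′)u′ = f` differ by at most `(1 − θ)⁻¹·C_Q(μ)·((e^{μ(n+1)}c0K_d(1) + λ)R_Δ + R_s)` in the weighted sup norm,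
`R_Δ`, `R_s` the difference letters of the two responses on `u′` ((65) §4 for the source, (66) §3 for the inverse). [folklore] -/
theorem weighted_nextScale_inverse_sub (hd : 3 ≤ d) (n : ℕ) {a : ℝ} (ha : 0 < a)
    (Dop Aop Pop Nop Nop' D D' : lp (fun _ : X d => ℝ) ∞ →L[ℝ] lp (fun _ : X d => ℝ) ∞)
    (hD : ∀ (f : lp (fun _ : X d => ℝ) ∞) (y : X d), Dop f y = (((n : ℝ) + 1) ^ d)⁻¹ * ∑ p ∈ B n y, f p)
    (hA : ∀ (f : lp (fun _ : X d => ℝ) ∞) (p : X d), Aop f p = ∑ r ∈ nbhd n p, AX n a p r * f r)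
    (hP : ∀ (f : lp (fun _ : X d => ℝ) ∞) (p : X d), Pop f p = f p - (((n : ℝ) + 1) ^ d)⁻¹ * ∑ p' ∈ B n (blk n p), f p')
    {g g' : X d → ℝ} {lam : ℝ} (hN : ∀ (f : lp (fun _ : X d => ℝ) ∞) (p : X d), Nop f p = g p * f p)
    (hN' : ∀ (f : lp (fun _ : X d => ℝ) ∞) (p : X d), Nop' f p = g' p * f p) (hg : ∀ p, |g p| ≤ lam)
    (hDD : ∀ v : lp (fun _ : X d => ℝ) ∞, Dop (D v) = v)
    (hDfib : ∀ v : lp (fun _ : X d => ℝ) ∞, Pop (Aop (D v) + Nop (D v)) = 0)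
    {μ : ℝ} (hμ0 : 0 ≤ μ) (hμU : μ < deltaU d a / 4)
    {ρ : X d → ℝ} (hρ : ∀ x y, ρ x - ρ y ≤ dist x y) {Mρ : ℝ} (hρb : ∀ y, |ρ y| ≤ Mρ) {K : ℝ}
    (hDwt : ∀ (v : lp (fun _ : X d => ℝ) ∞) (Rv : ℝ), (∀ y, Real.exp (μ * ρ y) * |v y| ≤ Rv) →
      ∀ p : X d, Real.exp (μ * ρ (blk n p)) * |D v p| ≤ K * Rv)
    (hθ : lam * K * (cU d a * latticeConst d (deltaU d a - μ)
        + 2 * (((cG0 d * cKL d (d - 2) + cSplit d a) * Real.exp (2 * deltaU d a)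
            + cFar d a * Real.exp (4 * deltaU d a) / deltaU d a ^ 2) * latticeConst d (deltaU d a / 4 - μ))) < 1)
    (u u' f : lp (fun _ : X d => ℝ) ∞) (hu : ∀ y, Dop (Aop (D u) + Nop (D u)) y = f y)
    (hu' : ∀ y, Dop (Aop (D' u') + Nop' (D' u')) y = f y) {RΔ Rs : ℝ}
    (hΔ : ∀ p : X d, Real.exp (μ * ρ (blk n p)) * |(D u' - D' u') p| ≤ RΔ)
    (hs : ∀ q : X d, Real.exp (μ * ρ (blk n q)) * |(g q - g' q) * D' u' q| ≤ Rs) (z : X d) :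
    Real.exp (μ * ρ z) * |(u - u') z|
      ≤ (1 - lam * K * (cU d a * latticeConst d (deltaU d a - μ)
          + 2 * (((cG0 d * cKL d (d - 2) + cSplit d a) * Real.exp (2 * deltaU d a)
              + cFar d a * Real.exp (4 * deltaU d a) / deltaU d a ^ 2) * latticeConst d (deltaU d a / 4 - μ))))⁻¹
        * (cU d a * latticeConst d (deltaU d a - μ)
          * ((Real.exp (μ * ((n : ℝ) + 1)) * (c0 d n a * latticeConst d 1) + lam) * RΔ + Rs)) := by
  -- the source: `R(w)(u − u′) = R(w′)u′ − R(w)u′`, sitewise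
  have hsrc : ∀ y, Dop (Aop (D (u - u')) + Nop (D (u - u'))) y
      = (Dop (Aop (D' u') + Nop' (D' u')) - Dop (Aop (D u') + Nop (D u'))) y := by
    intro y
    have e : Dop (Aop (D (u - u')) + Nop (D (u - u')))
        = Dop (Aop (D u) + Nop (D u)) - Dop (Aop (D u') + Nop (D u')) := by
      rw [map_sub, map_sub, map_sub, ← map_sub Dop]; congr 1; abel
    rw [e, lp.coeFn_sub, Pi.sub_apply, hu y, ← hu' y, lp.coeFn_sub, Pi.sub_apply]
  -- its weighted size, by (65) §4 (with the roles of the two responses exchanged under the absolute value)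
  have hsz : ∀ y, Real.exp (μ * ρ y) * |(Dop (Aop (D' u') + Nop' (D' u')) - Dop (Aop (D u') + Nop (D u'))) y|
      ≤ (Real.exp (μ * ((n : ℝ) + 1)) * (c0 d n a * latticeConst d 1) + lam) * RΔ + Rs := by
    intro y
    have h := weighted_nextScale_sub_of_letters n ha Dop Aop Nop Nop' D D' hD hA hN hN' hg hμ0 hρ u' hΔ hs y
    rwa [lp.coeFn_sub, Pi.sub_apply, abs_sub_comm, ← Pi.sub_apply, ← lp.coeFn_sub] at h
  exact weighted_nextScale_inverse_apriori hd n ha Dop Aop Pop Nop D hD hA hP hN hg hDD hDfib hμ0 hμU hρ hρb hDwt hθ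
    (u - u') (Dop (Aop (D' u') + Nop' (D' u')) - Dop (Aop (D u') + Nop (D u'))) hsrc hsz z

end Summit.QuantumFields.BalabanUV.T4Continuum.NE7b.SupNextScalePropagatorModulus

end
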